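import Summits.Ventures.PercRepro.C025ProfileParallel
import Summits.Ventures.PercRepro.C025ProfileHallZero

/-!
# C-033 «SHADOW HALL (H⁺)» — the parallel-pair step of the row `q = 1` for every family (night-3 g6)

`Profile.HallIneq M q u` is the Hall inequality `(H⁺_{q,u})` of one matroid (`ProfileHall = ∀ M q u, q < u → HallIneq M q u`).
`hallIneq_one_of_delete_parallel`: for a loopless finite matroid with `e ∥ f`, `(H⁺_{1,u+1})` on `M ＼ {e}` implies
`(H⁺_{1,u+1})` on `M`. Proof: for a family `𝒜` of rank-`1` sets, split by `e ∈ B`; the shadow splits by `e ∈ S`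
(`card_shadowLevel_ge`: the `e`-free part is the `M ＼ e`-shadow of `𝒜₀`, the `e`-part contains `insert e` of the
`M ／ e`-shadow of `contractFamily` = the erased members containing `e` plus the parallel class if it is a member);
prices: (L1) `price_eq_price_delete_of_mem_closure` off the parallel class, (L2) `price_insert_le_price_contract`,
(L3) `price_pair_le` at the parallel class (C025ProfileParallel); the rank-`0` Hall statement on `M ／ {e}` is
`profileHall_zero` (C025ProfileHallZero). With the loop step and the simple case this would give `(H⁺_{1,u})` for every
matroid; the simple case (families of points of a simple matroid) is NOT proved here.
-/

open scoped Matroid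

namespace PercRepro

open Set Finset ThmH

namespace Profile

/-- The Hall inequality `(H⁺_{q,u})` of one matroid: for every family `𝒜` of rank-`q` sets, the total price of `𝒜`
is at most the number of rank-`u` sets containing a member of `𝒜`. `ProfileHall = ∀ M q u, q < u → HallIneq M q u`. -/
def HallIneq {α : Type} [DecidableEq α] (M : Matroid α) [M.Finite] (q u : ℕ) : Prop :=
  ∀ 𝒜 ⊆ Rq M q, ∑ B ∈ 𝒜, price M q u B ≤ ((Shadow.shadowLevel M u 𝒜).card : ℚ)

end Profile

section HallParallel

variable {α : Type} [DecidableEq α] {M : Matroid α} [M.Finite]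

/-- Membership in the shadow of a family at a level. -/
theorem mem_shadowLevel {u : ℕ} {𝒜 : Finset (Finset α)} {S : Finset α} :
    S ∈ Shadow.shadowLevel M u 𝒜 ↔ S ∈ Shadow.levelSet M u ∧ ∃ B ∈ 𝒜, B ⊆ S := by
  simp only [Shadow.shadowLevel, Finset.mem_filter]

/-- The part of the shadow avoiding `e` is the `M ＼ {e}`-shadow of the members avoiding `e`. -/
theorem filter_notMem_shadowLevel_eq (e : α) (u : ℕ) (𝒜 : Finset (Finset α)) :
    (Shadow.shadowLevel M u 𝒜).filter (fun S => e ∉ S) =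
      Shadow.shadowLevel (M ＼ ({e} : Set α)) u (𝒜.filter (fun B => e ∉ B)) := by
  have hlev := filter_notMem_levelSet_eq (M := M) e u
  ext S
  simp only [Finset.mem_filter, mem_shadowLevel]
  constructor
  · rintro ⟨⟨hS, B, hB, hBS⟩, heS⟩
    refine ⟨?_, B, ⟨hB, fun h => heS (hBS h)⟩, hBS⟩
    rw [← hlev, Finset.mem_filter]; exact ⟨hS, heS⟩
  · rintro ⟨hS, B, hB, hBS⟩
    rw [← hlev, Finset.mem_filter] at hS
    exact ⟨⟨hS.1, B, hB.1, hBS⟩, hS.2⟩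

/-- The family fed to `M ／ {e}`: the members containing `e`, erased, together with the parallel class if it is a member. -/
noncomputable def contractFamily (M : Matroid α) [M.Finite] (e : α) (𝒜 : Finset (Finset α)) : Finset (Finset α) :=
  (𝒜.filter (fun B => e ∈ B)).image (fun B => B.erase e) ∪ 𝒜.filter (fun B => e ∉ B ∧ B = parClass M e)

/-- The `M ／ {e}`-shadow (level `u`) of `contractFamily` embeds, via `insert e`, into the part of the `M`-shadow
(level `u+1`) containing `e`. -/
theorem card_contractFamily_shadow_le {e : α} (he : M.Indep {e}) (u : ℕ) (𝒜 : Finset (Finset α)) :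
    (Shadow.shadowLevel (M ／ ({e} : Set α)) u (contractFamily M e 𝒜)).card ≤
      ((Shadow.shadowLevel M (u + 1) 𝒜).filter (fun S => e ∈ S)).card := by
  have hlev := image_erase_filter_mem_levelSet_eq (M := M) he u
  apply Finset.card_le_card_of_injOn (fun S' => insert e S')
  · intro S' hS'
    rw [Finset.mem_coe, mem_shadowLevel] at hS'
    obtain ⟨hS'lev, B₂, hB₂, hB₂S'⟩ := hS'
    rw [← hlev, Finset.mem_image] at hS'lev
    obtain ⟨S, hS, rfl⟩ := hS'lev
    rw [Finset.mem_filter] at hS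
    rw [Finset.mem_coe, Finset.mem_filter]
    dsimp only
    rw [Finset.insert_erase hS.2, mem_shadowLevel]
    refine ⟨⟨hS.1, ?_⟩, hS.2⟩
    unfold contractFamily at hB₂
    rw [Finset.mem_union, Finset.mem_image, Finset.mem_filter] at hB₂
    rcases hB₂ with ⟨B, hB, rfl⟩ | ⟨hB, _, rfl⟩
    · rw [Finset.mem_filter] at hB
      refine ⟨B, hB.1, ?_⟩
      intro x hx
      by_cases hxe : x = e
      · subst hxe; exact hS.2
      · exact (Finset.mem_erase.1 (hB₂S' (Finset.mem_erase.2 ⟨hxe, hx⟩))).2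
    · exact ⟨parClass M e, hB, fun x hx => (Finset.mem_erase.1 (hB₂S' hx)).2⟩
  · intro S₁ hS₁ S₂ hS₂ h
    simp only at h
    rw [Finset.mem_coe, mem_shadowLevel] at hS₁ hS₂
    have h₁ : e ∉ S₁ := by
      intro heS
      have := hS₁.1
      rw [Profile.mem_levelSet, gr_contract_singleton] at this
      exact (Finset.mem_erase.1 (this.1 heS)).1 rfl
    have h₂ : e ∉ S₂ := by
      intro heS
      have := hS₂.1
      rw [Profile.mem_levelSet, gr_contract_singleton] at this
      exact (Finset.mem_erase.1 (this.1 heS)).1 rfl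
    rw [← Finset.erase_insert h₁, ← Finset.erase_insert h₂, h]

/-- The shadow split at a non-loop `e`: `#∂_{u+1}^M 𝒜 ≥ #∂_{u+1}^{M＼e} 𝒜₀ + #∂_u^{M／e} (contractFamily)`. -/
theorem card_shadowLevel_ge {e : α} (he : M.Indep {e}) (u : ℕ) (𝒜 : Finset (Finset α)) :
    (Shadow.shadowLevel (M ＼ ({e} : Set α)) (u + 1) (𝒜.filter (fun B => e ∉ B))).card +
      (Shadow.shadowLevel (M ／ ({e} : Set α)) u (contractFamily M e 𝒜)).card ≤
      (Shadow.shadowLevel M (u + 1) 𝒜).card := by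
  rw [← filter_notMem_shadowLevel_eq]
  calc ((Shadow.shadowLevel M (u + 1) 𝒜).filter (fun S => e ∉ S)).card +
        (Shadow.shadowLevel (M ／ ({e} : Set α)) u (contractFamily M e 𝒜)).card
      ≤ ((Shadow.shadowLevel M (u + 1) 𝒜).filter (fun S => e ∉ S)).card +
        ((Shadow.shadowLevel M (u + 1) 𝒜).filter (fun S => e ∈ S)).card :=
        Nat.add_le_add_left (card_contractFamily_shadow_le he u 𝒜) _
    _ = (Shadow.shadowLevel M (u + 1) 𝒜).card := by
        rw [add_comm, Finset.card_filter_add_card_filter_not]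

/-- **The parallel-pair step of `(H⁺_{1,u+1})`**: for a loopless matroid with `e ∥ f`, `(H⁺_{1,u+1})` on `M ＼ {e}`
implies `(H⁺_{1,u+1})` on `M` (the rank-`0` Hall statement on `M ／ {e}` is `profileHall_zero`). -/
theorem hallIneq_one_of_delete_parallel (hl : ∀ x ∈ M.E, M.IsNonloop x) {e f : α} (hfE : f ∈ M.E) (hfe : f ≠ e)
    (hef : e ∈ M.closure {f}) (u : ℕ) (h : Profile.HallIneq (M ＼ ({e} : Set α)) 1 (u + 1)) :
    Profile.HallIneq M 1 (u + 1) := by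
  classical
  intro 𝒜 h𝒜
  have heE : e ∈ M.E := M.closure_subset_ground _ hef
  have he : M.Indep {e} := M.indep_singleton.2 (hl e heE)
  have heg : e ∈ gr M := by rw [← Finset.mem_coe, coe_gr]; exact heE
  have hS1 : (Profile.Rq M 1).filter (fun B => e ∉ B) = Profile.Rq (M ＼ ({e} : Set α)) 1 :=
    filter_notMem_levelSet_eq e 1
  have hS0 : ((Profile.Rq M 1).filter (fun B => e ∈ B)).image (fun B => B.erase e) =
      Profile.Rq (M ／ ({e} : Set α)) 0 := image_erase_filter_mem_levelSet_eq he 0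
  have h𝒜₀sub : 𝒜.filter (fun B => e ∉ B) ⊆ Profile.Rq (M ＼ ({e} : Set α)) 1 := by
    rw [← hS1]
    exact Finset.filter_subset_filter _ h𝒜
  have hcf : contractFamily M e 𝒜 ⊆ Profile.Rq (M ／ ({e} : Set α)) 0 := by
    unfold contractFamily
    apply Finset.union_subset
    · rw [← hS0]
      exact Finset.image_subset_image (Finset.filter_subset_filter _ h𝒜)
    · intro B hB
      rw [Finset.mem_filter] at hB
      rw [hB.2.2]
      exact (parClass_mem hl hfE hfe hef he).2
  have hsplit := card_shadowLevel_ge he u 𝒜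
  have h1 := h _ h𝒜₀sub
  have hz := profileHall_zero (M := M ／ ({e} : Set α)) u hcf
  rw [← Finset.sum_filter_add_sum_filter_not 𝒜 (fun B => e ∈ B)]
  set 𝒜₁ := (𝒜.filter (fun B => e ∈ B)).image (fun B => B.erase e) with h𝒜₁
  set 𝒜P := 𝒜.filter (fun B => e ∉ B ∧ B = parClass M e) with h𝒜P
  set g : Finset α → ℚ := fun B' => Profile.price M 1 (u + 1) (insert e B') with hg
  set pc : Finset α → ℚ := fun B' => Profile.price (M ／ ({e} : Set α)) 0 u B' with hpc
  -- the members containing e, re-indexed by their erasure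
  have hA : ∑ B ∈ 𝒜.filter (fun B => e ∈ B), Profile.price M 1 (u + 1) B = ∑ B' ∈ 𝒜₁, g B' := by
    rw [h𝒜₁, Finset.sum_image (erase_injOn_filter_mem 𝒜 e)]
    apply Finset.sum_congr rfl
    intro B hB
    simp only [hg]
    rw [Finset.insert_erase (Finset.mem_filter.1 hB).2]
  -- (L2) on the part of 𝒜₁ outside the parallel class
  have hL2 : ∑ B' ∈ 𝒜₁ \ 𝒜P, g B' ≤ ∑ B' ∈ 𝒜₁ \ 𝒜P, pc B' :=
    Finset.sum_le_sum (fun B' _ => price_insert_le_price_contract he u B')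
  -- the members avoiding e: equal prices off the parallel class, (L3) at the parallel class
  have hsubP : 𝒜P ⊆ 𝒜.filter (fun B => e ∉ B) := by
    intro B hB; rw [h𝒜P, Finset.mem_filter] at hB; rw [Finset.mem_filter]; exact ⟨hB.1, hB.2.1⟩
  have hB : ∑ B ∈ 𝒜.filter (fun B => e ∉ B), Profile.price M 1 (u + 1) B ≤
      ∑ B ∈ 𝒜.filter (fun B => e ∉ B), Profile.price (M ＼ ({e} : Set α)) 1 (u + 1) B +
        (∑ B ∈ 𝒜P, pc B - ∑ B ∈ 𝒜P, g B) := by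
    rw [← Finset.sum_sdiff hsubP, ← Finset.sum_sdiff (f := fun B => Profile.price (M ＼ ({e} : Set α)) 1 (u + 1) B) hsubP,
      ← Finset.sum_sub_distrib]
    have hoff : ∀ B ∈ 𝒜.filter (fun B => e ∉ B) \ 𝒜P,
        Profile.price M 1 (u + 1) B = Profile.price (M ＼ ({e} : Set α)) 1 (u + 1) B := by
      intro B hB
      rw [Finset.mem_sdiff, Finset.mem_filter, h𝒜P, Finset.mem_filter] at hB
      have hBR := h𝒜 hB.1.1
      rw [Profile.mem_Rq] at hBR
      have hBsub : B ⊆ (gr M).erase e := fun x hx => Finset.mem_erase.2 ⟨fun h => hB.1.2 (h ▸ hx), hBR.1 hx⟩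
      by_cases hcl : e ∈ M.closure ((M.E \ {e}) \ (B : Set α))
      · exact price_eq_price_delete_of_mem_closure heg _ hBsub hcl
      · exact absurd ⟨hB.1.1, hB.1.2, eq_parClass_of_eRk_one hl hfE hfe hef hBsub (by exact_mod_cast hBR.2) hcl⟩ hB.2
    have hP : ∀ B ∈ 𝒜P, Profile.price M 1 (u + 1) B ≤
        Profile.price (M ＼ ({e} : Set α)) 1 (u + 1) B + (pc B - g B) := by
      intro B hB
      rw [h𝒜P, Finset.mem_filter] at hB
      have hBR := h𝒜 hB.1
      rw [Profile.mem_Rq] at hBR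
      have hBsub : B ⊆ (gr M).erase e := fun x hx => Finset.mem_erase.2 ⟨fun h => hB.2.1 (h ▸ hx), hBR.1 hx⟩
      have h3 := price_pair_le he u hBsub
      simp only [hpc, hg]
      linarith
    rw [Finset.sum_congr rfl hoff]
    have h5 := Finset.sum_le_sum hP
    rw [Finset.sum_add_distrib] at h5
    linarith
  -- bookkeeping of the contraction family
  have hcfsum : ∑ B ∈ contractFamily M e 𝒜, pc B = ∑ B ∈ 𝒜P, pc B + ∑ B' ∈ 𝒜₁ \ 𝒜P, pc B' := by
    unfold contractFamily
    rw [← Finset.sum_union Finset.disjoint_sdiff, Finset.union_sdiff_self_eq_union, Finset.union_comm]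
  have hdec : ∑ B' ∈ 𝒜₁, g B' = ∑ B' ∈ 𝒜₁ \ 𝒜P, g B' + ∑ B' ∈ 𝒜₁ ∩ 𝒜P, g B' := by
    rw [← Finset.sum_sdiff (f := g) (Finset.inter_subset_left (s₂ := 𝒜P)), Finset.sdiff_inter_self_left]
  have hint : ∑ B' ∈ 𝒜₁ ∩ 𝒜P, g B' ≤ ∑ B ∈ 𝒜P, g B :=
    Finset.sum_le_sum_of_subset_of_nonneg Finset.inter_subset_right
      (fun B _ _ => Profile.price_nonneg (M := M) 1 (u + 1) (insert e B))
  have hsplit' : ((Shadow.shadowLevel (M ＼ ({e} : Set α)) (u + 1) (𝒜.filter (fun B => e ∉ B))).card : ℚ) +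
      ((Shadow.shadowLevel (M ／ ({e} : Set α)) u (contractFamily M e 𝒜)).card : ℚ) ≤
      ((Shadow.shadowLevel M (u + 1) 𝒜).card : ℚ) := by exact_mod_cast hsplit
  have hz' : ∑ B ∈ contractFamily M e 𝒜, pc B ≤
      ((Shadow.shadowLevel (M ／ ({e} : Set α)) u (contractFamily M e 𝒜)).card : ℚ) := hz
  linarith [hA, hL2, hB, hcfsum, hdec, hint, hz', h1, hsplit']

end HallParallel

end PercRepro
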